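import Mathlib
import HarnessLib
import Literature.AlgebraicGeometry.Resolution.ProjectiveSpaceRegular
import Summits.ResolutionOfSingularities.ResolutionOfSingularities.Theorems.WildQuotientsGaloisQuotientStableCover
import Summits.ResolutionOfSingularities.ResolutionOfSingularities.Theorems.WildQuotientsWildQuotientResolutionS1aNodeAtlas

/-!
# S1a — stub `stub_initialAtlas` of line `s1a-logminvertex` v4/v5 CLOSED (by name): the INITIAL node atlas

[OURS · L1 W4.5c · lead-1 g6] — NOT a statement of the manuscript; counted 0; AI-level work, weaker than expert
review. Crux stmt-ResolutionOfSingularities-17941 (`WildQuotients.CyclicQuotientFourfolds`), skeleton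
`Cruxes/CyclicQuotientFourfolds/Lines/s1a_logminvertex.lean` v4 «GLOBAL FRAME» (plan-1 g11). The regular `X′` with the
action `ρ` over `X₁` (`ρ g ≫ q = q`), `q` affine, `X₁` separated, `X′` locally Noetherian, carries a NODE ATLAS
(`NodeAtlas p ⟨ρ, hq⟩ g₀`) for every `g₀` with `g₀ ^ p = 1`: the charts are the preimages `q⁻¹ W` of affine opens
`W ⊆ X₁` (`G`-stable, affine, affine over the separated `X₁`), the node is `B = Γ(X′, q⁻¹ W)` with the TRIVIAL grading
(`m = 0`, `𝒜 _ = ⊤`, `e = ` the tautological iso) and `σ =` the action of `g₀` on sections (pull back along `g₀⁻¹`,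
`ActionOver.act`); tameness: Noetherian (`IsLocallyNoetherian.component_noetherian`), regular
(`Scheme.IsRegular.isRegularRing_of_isAffineOpen`), (T1)/(T2) trivial, `σ^[p] = id` from `g₀ ^ p = 1`.

* `exists_trivialGradedRing` — the trivial grading of a commutative ring by a one-element index type;
* `ActionOver.act_pow_apply` — iterates of the action on sections;
* **`S1.stub_initialAtlas`** — the registered stub, signature verbatim.
-/

set_option linter.dupNamespace false

noncomputable section

open CategoryTheory CategoryTheory.Limits AlgebraicGeometry TopologicalSpace DirectSum
open Literature.AlgebraicGeometry.Resolution Literature.AlgebraicGeometry.RelativeSpec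
open Summit.ResolutionOfSingularities.ResolutionOfSingularities.Theorems
open Summit.ResolutionOfSingularities.ResolutionOfSingularities.Theorems.WildQuotientResolution
open Summit.ResolutionOfSingularities.ResolutionOfSingularities.Theorems.WildQuotientResolution.S1.ProducerStep
open Summit.ResolutionOfSingularities.ResolutionOfSingularities.Theorems.WildQuotientResolution.S1.NodeAtlas

namespace Summit.ResolutionOfSingularities.ResolutionOfSingularities.Theorems.WildQuotientResolution.S1

/-! ## The trivial grading -/

/-- **The trivial grading** of a commutative ring `B` by a one-element index type: `𝒜 _ = ⊤`, a `GradedRing`, with the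
tautological ring iso `B ≃+* 𝒜 0`. [folklore] -/
theorem exists_trivialGradedRing (ι : Type) [AddMonoid ι] [DecidableEq ι] [Subsingleton ι] (B : Type) [CommRing B] :
    ∃ (𝒜 : ι → AddSubgroup B) (_ : GradedRing 𝒜), (∀ i, 𝒜 i = ⊤) ∧
      ∃ e : B ≃+* ↥(𝒜 0), ∀ b : B, ((e b : ↥(𝒜 0)) : B) = b := by
  classical
  let 𝒜 : ι → AddSubgroup B := fun _ => ⊤
  haveI : SetLike.GradedMonoid 𝒜 :=
    { one_mem := AddSubgroup.mem_top _
      mul_mem := fun _ _ _ _ _ _ => AddSubgroup.mem_top _ }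
  let dec : B → ⨁ i, ↥(𝒜 i) := fun s => DirectSum.of (fun i => ↥(𝒜 i)) 0 ⟨s, AddSubgroup.mem_top _⟩
  have hcoe_of : ∀ x : ↥(𝒜 0), (DirectSum.coeAddMonoidHom 𝒜) (DirectSum.of (fun i => ↥(𝒜 i)) 0 x) = (x : B) :=
    fun x => DirectSum.coeAddMonoidHom_of 𝒜 0 x
  letI : DirectSum.Decomposition 𝒜 :=
    { decompose' := dec
      left_inv := fun s => hcoe_of ⟨s, AddSubgroup.mem_top _⟩
      right_inv := fun x => by
        change dec ((DirectSum.coeAddMonoidHom 𝒜) x) = x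
        induction x using DirectSum.induction_on with
        | zero =>
          rw [map_zero]
          change DirectSum.of (fun i => ↥(𝒜 i)) 0 ⟨0, _⟩ = 0
          have : (⟨(0 : B), AddSubgroup.mem_top _⟩ : ↥(𝒜 0)) = 0 := rfl
          rw [this, map_zero]
        | of i y =>
          obtain rfl : i = 0 := Subsingleton.elim _ _
          rw [hcoe_of]
        | add x y hx hy =>
          rw [map_add]
          change DirectSum.of (fun i => ↥(𝒜 i)) 0 ⟨_, _⟩ = _
          have : (⟨(DirectSum.coeAddMonoidHom 𝒜) x + (DirectSum.coeAddMonoidHom 𝒜) y, AddSubgroup.mem_top _⟩ :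
              ↥(𝒜 0)) =
              ⟨(DirectSum.coeAddMonoidHom 𝒜) x, AddSubgroup.mem_top _⟩ +
                ⟨(DirectSum.coeAddMonoidHom 𝒜) y, AddSubgroup.mem_top _⟩ := rfl
          rw [this, map_add]
          exact congrArg₂ (· + ·) hx hy }
  letI : GradedRing 𝒜 := {}
  let e : B ≃+* ↥(𝒜 0) :=
    { toFun := fun s => ⟨s, AddSubgroup.mem_top _⟩
      invFun := fun x => (x : B)
      left_inv := fun _ => rfl
      right_inv := fun _ => rfl
      map_mul' := fun _ _ => rfl
      map_add' := fun _ _ => rfl }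
  exact ⟨𝒜, inferInstance, fun _ => rfl, e, fun _ => rfl⟩

/-! ## Iterating the action on sections -/

/-- `(act g)^[n] = act (g ^ n)` on `Γ(X, r⁻¹ U)`. -/
theorem ActionOver.act_pow_apply {X Y : Scheme.{0}} {r : X ⟶ Y} {G : Type} [Group G] (ρ : ActionOver r G)
    (g : G) (U : Y.Opens) (n : ℕ) (b : Γ(X, r ⁻¹ᵁ U)) : (⇑(ρ.act g U))^[n] b = ρ.act (g ^ n) U b := by
  induction n generalizing b with
  | zero => rw [Function.iterate_zero, pow_zero, ρ.act_one]; rfl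
  | succ n ih => rw [Function.iterate_succ_apply, ih, pow_succ, ρ.act_mul]; rfl

/-! ## The initial node atlas -/

/-- **`stub_initialAtlas` (line `s1a-logminvertex` v4/v5)**: the regular `X′` with the action `ρ` over a separated
`X₁` along an affine invariant `q` carries a node atlas for any `g₀` with `g₀ ^ p = 1` (`0 < p`). [OURS · L1 W4.5c] -/
theorem stub_initialAtlas :
    ∀ p : ℕ, 0 < p → ∀ {X' X₁ : Scheme.{0}} (q : X' ⟶ X₁) (G : Type) [Group G] [Finite G]
      (ρ : G →* Aut X') (g₀ : G), g₀ ^ p = 1 → ∀ (hq : ∀ g : G, (ρ g).hom ≫ q = q)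
      [X₁.IsSeparated] [IsAffineHom q] [IsLocallyNoetherian X'], Scheme.IsRegular X' →
      NodeAtlas p (⟨ρ, hq⟩ : ActionOver q G) g₀ := by
  intro p _ X' X₁ q G _ _ ρ g₀ hg₀ hq _ _ _ hreg v
  classical
  -- an affine open of the base through `q v`
  obtain ⟨W, hW, hvW, -⟩ :=
    exists_isAffineOpen_mem_and_subset (X := X₁) (x := q.base v) (U := ⊤) (Opens.mem_top _)
  -- the chart `q⁻¹ W`
  have hst : ∀ g : G, ((⟨ρ, hq⟩ : ActionOver q G).aut g).hom ⁻¹ᵁ (q ⁻¹ᵁ W) = q ⁻¹ᵁ W :=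
    fun g => (⟨ρ, hq⟩ : ActionOver q G).preimage_preimage g W
  have hOaff : IsAffineOpen (q ⁻¹ᵁ W) := hW.preimage q
  haveI : IsAffine (q ⁻¹ᵁ W : X'.Opens) := hOaff
  haveI : IsAffineHom ((q ⁻¹ᵁ W).ι ≫ q) := isAffineHom_of_isAffine_of_isSeparated _
  refine ⟨⟨q ⁻¹ᵁ W, hst, inferInstance⟩, hvW, hOaff, ?_⟩
  -- the node: trivial grading on `B = Γ(X′, q⁻¹ W)`, `σ =` the action of `g₀`
  obtain ⟨𝒜, _, h𝒜, e, he⟩ :=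
    exists_trivialGradedRing (Π j : Fin 0, ZMod ((![] : Fin 0 → ℕ) j)) Γ(X', q ⁻¹ᵁ W)
  let σ : Γ(X', q ⁻¹ᵁ W) ≃+* Γ(X', q ⁻¹ᵁ W) :=
    RingEquiv.ofRingHom ((⟨ρ, hq⟩ : ActionOver q G).act g₀ W) ((⟨ρ, hq⟩ : ActionOver q G).act g₀⁻¹ W)
      (by rw [← ActionOver.act_mul, mul_inv_cancel, ActionOver.act_one])
      (by rw [← ActionOver.act_mul, inv_mul_cancel, ActionOver.act_one])
  have hσ : ∀ b, σ b = (⟨ρ, hq⟩ : ActionOver q G).act g₀ W b := fun _ => rfl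
  haveI : IsNoetherianRing Γ(X', q ⁻¹ᵁ W) := IsLocallyNoetherian.component_noetherian ⟨q ⁻¹ᵁ W, hOaff⟩
  have hreg' : IsRegularRing Γ(X', q ⁻¹ᵁ W) := hreg.isRegularRing_of_isAffineOpen hOaff
  refine ⟨0, ![], Γ(X', q ⁻¹ᵁ W), inferInstance, 𝒜, inferInstance, σ, e, ⟨inferInstance, hreg', ?_, ?_, ?_, ?_⟩, ?_⟩
  · -- (T1): the index group is trivial
    exact ⟨∅, fun _ h => absurd h (Finset.notMem_empty _), inferInstance⟩
  · -- (T2): `𝒜 0 = ⊤`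
    refine ⟨∅, eq_top_iff.mpr fun b _ => Subring.subset_closure (Or.inl ?_)⟩
    rw [h𝒜 0]; exact AddSubgroup.mem_top b
  · -- `σ` is graded
    intro d b _; rw [h𝒜 d]; exact AddSubgroup.mem_top _
  · -- `σ^[p] = id`
    intro b
    rw [show (⇑σ) = ⇑((⟨ρ, hq⟩ : ActionOver q G).act g₀ W) from funext hσ, ActionOver.act_pow_apply, hg₀,
      ActionOver.act_one]
    rfl
  · -- the intertwining is tautological
    intro t
    rw [he, he, hσ]
    rfl

end Summit.ResolutionOfSingularities.ResolutionOfSingularities.Theorems.WildQuotientResolution.S1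

end
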